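import Summits.Ventures.YMGap.RobustBall.LoopScreeningTilt
import Summits.Ventures.YMGap.RobustBall.SpecificationConcentration
import Literature.Probability.LatticeModels.BoundaryLawFunctionalLevels
import Literature.Probability.LatticeModels.GibbsSpecificationDLRProofs
import HarnessLib

/-!
# Venture YMGap, track ROBUST-BALL — VARIANCE IS AT LEAST THE SUM OF THE ONE-SITE CONDITIONAL FLOORS OVER A SPARSE FAMILY
# (abstract specifications; law of total variance through consistent kernels, no product structure)

HONEST FRAMING. WHAT THIS IS: a venture file (cell `pub-ymgap`, track Y2 ROBUST-BALL, seat ds-3, theorems only): the abstract engine of the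
object «C-CLT-ND» (non-degeneracy of the central limit theorem). For a specification `γ` (Georgii: proper, consistent kernels `γ_Λ(·|η)`)
on `V → S`, a bounded measurable observable `S₀`, a finite family `E` of sites and, for each `e ∈ E`, a bounded measurable "local part"
`g_e` and a "floor" `f_e` with:
(F) `f_e(σ) ≤ ∫ (g_e − c)² dγ_{e}(·|σ)` for all `σ, c` (the one-site kernel spreads `g_e`);
(P) `∫ g_e dγ_{E'}(·|σ) = g_e(σ)` for `E' ⊆ E ∖ {e}` (`g_e` does not read the other sites of the family);
(C) `σ ↦ ∫ (S₀ − g_e) dγ_{E'}(·|σ)` does not read the site `e`, for `E' ⊆ E ∖ {e}` (SPARSITY: after removing its local part, averaging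
    over the other sites of the family produces nothing that depends on `e` — for a nearest-neighbour interaction this is «no two sites of
    `E` interact»),
we prove ★ `sum_integral_floor_le_variance_kernel`: for every `E' ⊆ E` and every `η`,
`Σ_{e∈E'} ∫ f_e dγ_{E'}(·|η) ≤ Var_{γ_{E'}(·|η)}(S₀)`, and ★★ `sum_integral_floor_le_variance`: for every Gibbs measure `μ`,
`Σ_{e∈E} ∫ f_e dμ ≤ Var_μ(S₀)`. The induction peels one site: `Var_{γ_{E'∪{e}}}(S₀) = E[Var_{γ_{E'}}(S₀)] + Var(γ_{E'} S₀)`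
(consistency + bias–variance), `Var_{γ_{E'∪{e}}}(γ_{E'} S₀) ≥ E[Var_{γ_{e}}(γ_{E'} S₀)]` (consistency again) and
`Var_{γ_{e}(·|σ)}(γ_{E'} S₀) = Var_{γ_{e}(·|σ)}(g_e) ≥ f_e(σ)` ((P), (C), properness). No product measure, no independence is used.
WHAT THIS IS NOT: no lattice, no gauge field (that is `PlaquetteSusceptibilityFloor.lean`); nothing about the continuum or Clay.
References: law of total variance (folklore); H.-O. Georgii, *Gibbs Measures and Phase Transitions* (2011), Def. 1.23, (1.26).
-/

noncomputable section

open MeasureTheory ProbabilityTheory Real Finset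
open Literature.Probability.LatticeModels
open Summit.Ventures.YMGap.RobustBall.LoopScreening

namespace Summit.Ventures.YMGap.RobustBall

namespace KernelVariance

variable {V S : Type*} [MeasurableSpace S] {γ : Specification V S}

/-! ### Bounded measurable observables and kernel averages -/

/-- A bounded measurable real observable is integrable for every probability measure. [folklore] -/
theorem integrable_of_abs_le {Ω : Type*} [MeasurableSpace Ω] {ν : Measure Ω} [IsFiniteMeasure ν] {X : Ω → ℝ}
    (hX : Measurable X) {M : ℝ} (hM : ∀ ω, |X ω| ≤ M) : Integrable X ν :=
  (integrable_const M).mono' hX.aestronglyMeasurable (Filter.Eventually.of_forall fun ω => by simpa [Real.norm_eq_abs] using hM ω)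

/-- `|∫ X dγ_Λ(·|σ)| ≤ M` for `|X| ≤ M`. [folklore] -/
theorem abs_integral_kernel_le (hγ : IsSpecification γ) (Λ : Finset V) {X : (V → S) → ℝ} {M : ℝ} (hM : ∀ τ, |X τ| ≤ M)
    (σ : V → S) : |∫ τ, X τ ∂(γ Λ σ)| ≤ M := by
  haveI := hγ.isProbability Λ σ
  exact abs_integral_le_of_abs_le hM

/-- **Bias–variance**: for a probability measure, `∫ (X − c)² = ∫ (X − ∫X)² + (∫X − c)²`. [folklore] -/
theorem integral_sq_sub_eq {Ω : Type*} [MeasurableSpace Ω] {ν : Measure Ω} [IsProbabilityMeasure ν] {X : Ω → ℝ}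
    (hX : Measurable X) {M : ℝ} (hM : ∀ ω, |X ω| ≤ M) (c : ℝ) :
    ∫ ω, (X ω - c) ^ 2 ∂ν = ∫ ω, (X ω - ∫ ω', X ω' ∂ν) ^ 2 ∂ν + ((∫ ω', X ω' ∂ν) - c) ^ 2 := by
  set m := ∫ ω', X ω' ∂ν with hm
  have hiX : Integrable X ν := integrable_of_abs_le hX hM
  have hi1 : Integrable (fun ω => (X ω - m) ^ 2) ν :=
    integrable_comp_of_abs_le hX hM (f := fun x => (x - m) ^ 2) (by fun_prop)
  have hi3 : Integrable (fun ω => X ω - m) ν := hiX.sub (integrable_const m)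
  have hi2 : Integrable (fun ω => 2 * (m - c) * (X ω - m) + (m - c) ^ 2) ν := (hi3.const_mul _).add (integrable_const _)
  have hsplit : ∫ ω, (X ω - c) ^ 2 ∂ν = ∫ ω, ((X ω - m) ^ 2 + (2 * (m - c) * (X ω - m) + (m - c) ^ 2)) ∂ν :=
    integral_congr_ae (ae_of_all _ fun ω => by ring)
  have hadd : ∫ ω, ((X ω - m) ^ 2 + (2 * (m - c) * (X ω - m) + (m - c) ^ 2)) ∂ν =
      (∫ ω, (X ω - m) ^ 2 ∂ν) + ∫ ω, (2 * (m - c) * (X ω - m) + (m - c) ^ 2) ∂ν := integral_add hi1 hi2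
  have hadd2 : ∫ ω, (2 * (m - c) * (X ω - m) + (m - c) ^ 2) ∂ν =
      (∫ ω, 2 * (m - c) * (X ω - m) ∂ν) + ∫ ω, (m - c) ^ 2 ∂ν := integral_add (hi3.const_mul _) (integrable_const _)
  have hmul : ∫ ω, 2 * (m - c) * (X ω - m) ∂ν = 2 * (m - c) * ∫ ω, (X ω - m) ∂ν := integral_const_mul _ _
  have hsub0 : ∫ ω, (X ω - m) ∂ν = (∫ ω, X ω ∂ν) - ∫ ω, m ∂ν := integral_sub hiX (integrable_const m)
  rw [hsplit, hadd, hadd2, hmul, hsub0]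
  simp [hm]

/-- The conditional variance `σ ↦ Var_{γ_Λ(·|σ)}(X)` of a bounded measurable `X` is measurable and bounded by `(2M)²`. [folklore] -/
theorem measurable_variance_kernel (hγ : IsSpecification γ) (Λ : Finset V) {X : (V → S) → ℝ} (hX : Measurable X) {M : ℝ}
    (hM : ∀ σ, |X σ| ≤ M) :
    (Measurable fun σ => ∫ τ, (X τ - ∫ τ', X τ' ∂(γ Λ σ)) ^ 2 ∂(γ Λ σ)) ∧
      ∀ σ, |∫ τ, (X τ - ∫ τ', X τ' ∂(γ Λ σ)) ^ 2 ∂(γ Λ σ)| ≤ (M + M) ^ 2 := by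
  constructor
  · -- `Var = ∫ X² − (∫ X)²` pointwise, both pieces measurable in `σ`
    have hId : ∀ σ, ∫ τ, (X τ - ∫ τ', X τ' ∂(γ Λ σ)) ^ 2 ∂(γ Λ σ) = ∫ τ, X τ ^ 2 ∂(γ Λ σ) - (∫ τ, X τ ∂(γ Λ σ)) ^ 2 := by
      intro σ
      haveI := hγ.isProbability Λ σ
      have h := integral_sq_sub_eq (ν := γ Λ σ) hX hM 0
      simp only [sub_zero] at h
      linarith
    simp_rw [hId]
    exact (SpecConcentration.measurable_integral hγ Λ (hX.pow_const 2)).sub ((SpecConcentration.measurable_integral hγ Λ hX).pow_const 2)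
  · intro σ
    haveI := hγ.isProbability Λ σ
    rw [abs_of_nonneg (integral_nonneg fun τ => sq_nonneg _)]
    have hm' : |∫ τ', X τ' ∂(γ Λ σ)| ≤ M := abs_integral_le_of_abs_le hM
    refine (abs_integral_le_of_abs_le (M := (M + M) ^ 2) fun τ => ?_).trans' (le_abs_self _)
    rw [abs_pow, ← sq_abs (M + M)]
    exact pow_le_pow_left₀ (abs_nonneg _) ((abs_sub _ _).trans (by linarith [hM τ, le_abs_self (M + M)])) 2

/-! ### Bias–variance and the law of total variance through a consistent kernel -/

/-- **Total variance through a kernel that leaves the measure invariant.** Let `ν` be a probability measure with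
`∫∫ F dγ_Λ(·|σ) dν(σ) = ∫ F dν` for bounded measurable `F` (a Gibbs measure, or a larger kernel `γ_{Λ'}(·|η)`, `Λ ⊆ Λ'`), `X` bounded
measurable. Then `∫ Var_{γ_Λ(·|σ)}(X) dν(σ) ≤ Var_ν(X)`. [folklore] -/
theorem integral_variance_kernel_le (hγ : IsSpecification γ) (Λ : Finset V) {ν : Measure (V → S)} [IsProbabilityMeasure ν]
    (hcons : ∀ (F : (V → S) → ℝ), Measurable F → (∃ C, ∀ σ, |F σ| ≤ C) → ∫ σ, ∫ τ, F τ ∂(γ Λ σ) ∂ν = ∫ τ, F τ ∂ν)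
    {X : (V → S) → ℝ} (hX : Measurable X) {M : ℝ} (hM : ∀ σ, |X σ| ≤ M) :
    ∫ σ, ∫ τ, (X τ - ∫ τ', X τ' ∂(γ Λ σ)) ^ 2 ∂(γ Λ σ) ∂ν ≤ ∫ τ, (X τ - ∫ τ', X τ' ∂ν) ^ 2 ∂ν := by
  set m := ∫ τ', X τ' ∂ν with hm
  have hFm : Measurable fun τ => (X τ - m) ^ 2 := (hX.sub_const m).pow_const 2
  obtain ⟨C, hC⟩ : ∃ C, ∀ τ, |(X τ - m) ^ 2| ≤ C := by
    refine ⟨(M + |m|) ^ 2, fun τ => ?_⟩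
    rw [abs_pow, ← sq_abs (M + |m|)]
    exact pow_le_pow_left₀ (abs_nonneg _) ((abs_sub _ _).trans (by linarith [hM τ, le_abs_self (M + |m|), abs_nonneg m])) 2
  rw [← hcons _ hFm ⟨C, hC⟩]
  refine integral_mono_of_nonneg (ae_of_all _ fun σ => integral_nonneg fun τ => sq_nonneg _)
    (integrable_of_abs_le (SpecConcentration.measurable_integral hγ Λ hFm) (M := C) fun σ => abs_integral_kernel_le hγ Λ hC σ)
    (ae_of_all _ fun σ => ?_)
  haveI := hγ.isProbability Λ σ
  exact integral_sq_sub_integral_le hX hM m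

/-- The consistency identity in the form used above, for `Λ ⊆ Λ'` and the kernel `γ_{Λ'}(·|η)` as the measure. [folklore] -/
theorem integral_integral_kernel_eq (hγ : IsSpecification γ) {Λ Λ' : Finset V} (hsub : Λ ⊆ Λ') (η : V → S) (F : (V → S) → ℝ)
    (hF : Measurable F) (hFb : ∃ C, ∀ σ, |F σ| ≤ C) : ∫ σ, ∫ τ, F τ ∂(γ Λ σ) ∂(γ Λ' η) = ∫ τ, F τ ∂(γ Λ' η) := by
  haveI := hγ.isProbability Λ' η
  obtain ⟨C, hC⟩ := hFb
  exact hγ.integral_integral_eq_of_subset hsub η (integrable_of_abs_le hF hC)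

/-- **Variance splits through an inner kernel**: for `Λ ⊆ Λ'`, bounded measurable `X`,
`Var_{γ_{Λ'}(·|η)}(X) = ∫ Var_{γ_Λ(·|σ)}(X) dγ_{Λ'}(σ|η) + Var_{γ_{Λ'}(·|η)}(γ_Λ X)` (consistency + bias–variance). [folklore] -/
theorem variance_kernel_eq_add (hγ : IsSpecification γ) {Λ Λ' : Finset V} (hsub : Λ ⊆ Λ') (η : V → S) {X : (V → S) → ℝ}
    (hX : Measurable X) {M : ℝ} (hM : ∀ σ, |X σ| ≤ M) :
    ∫ τ, (X τ - ∫ τ', X τ' ∂(γ Λ' η)) ^ 2 ∂(γ Λ' η) =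
      (∫ σ, ∫ τ, (X τ - ∫ τ', X τ' ∂(γ Λ σ)) ^ 2 ∂(γ Λ σ) ∂(γ Λ' η)) +
        ∫ σ, ((∫ τ, X τ ∂(γ Λ σ)) - ∫ σ', ∫ τ, X τ ∂(γ Λ σ') ∂(γ Λ' η)) ^ 2 ∂(γ Λ' η) := by
  haveI := hγ.isProbability Λ' η
  set m := ∫ τ', X τ' ∂(γ Λ' η) with hm
  have hmX : ∫ σ', ∫ τ, X τ ∂(γ Λ σ') ∂(γ Λ' η) = m := integral_integral_kernel_eq hγ hsub η X hX ⟨M, hM⟩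
  rw [hmX]
  have hFm : Measurable fun τ => (X τ - m) ^ 2 := (hX.sub_const m).pow_const 2
  have hFb : ∃ C, ∀ τ, |(X τ - m) ^ 2| ≤ C := by
    refine ⟨(M + |m|) ^ 2, fun τ => ?_⟩
    rw [abs_pow, ← sq_abs (M + |m|)]
    exact pow_le_pow_left₀ (abs_nonneg _) ((abs_sub _ _).trans (by linarith [hM τ, le_abs_self (M + |m|), abs_nonneg m])) 2
  rw [← integral_integral_kernel_eq hγ hsub η _ hFm hFb]
  have hpt : ∀ σ, ∫ τ, (X τ - m) ^ 2 ∂(γ Λ σ) =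
      ∫ τ, (X τ - ∫ τ', X τ' ∂(γ Λ σ)) ^ 2 ∂(γ Λ σ) + ((∫ τ, X τ ∂(γ Λ σ)) - m) ^ 2 := fun σ => by
    haveI := hγ.isProbability Λ σ
    exact integral_sq_sub_eq hX hM m
  simp_rw [hpt]
  -- integrability of the two pieces
  obtain ⟨hvar_m, hvar_b⟩ := measurable_variance_kernel hγ Λ hX hM
  have hmean_m : Measurable fun σ => ((∫ τ, X τ ∂(γ Λ σ)) - m) ^ 2 := ((SpecConcentration.measurable_integral hγ Λ hX).sub_const m).pow_const 2
  have hmean_b : ∀ σ, |((∫ τ, X τ ∂(γ Λ σ)) - m) ^ 2| ≤ (M + |m|) ^ 2 := fun σ => by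
    rw [abs_pow, ← sq_abs (M + |m|)]
    exact pow_le_pow_left₀ (abs_nonneg _) ((abs_sub _ _).trans (by
      linarith [abs_integral_kernel_le hγ Λ hM σ, le_abs_self (M + |m|), abs_nonneg m])) 2
  exact integral_add (integrable_of_abs_le hvar_m hvar_b) (integrable_of_abs_le hmean_m hmean_b)

/-! ### The sparse-family induction -/

/-- **Variance on a one-site fibre ignores fibre-constant parts**: if `γ_{e}(·|σ)` lives on the fibre `{τ : τ = σ off e}` (properness)
and `h` does not read `e`, then `Var_{γ_e(·|σ)}(h + g) = Var_{γ_e(·|σ)}(g)`. [folklore] -/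
theorem variance_fibre_add_eq (hγ : IsSpecification γ) (e : V) (σ : V → S) {h g : (V → S) → ℝ} (hh : Measurable h)
    (hg : Measurable g) {Mh Mg : ℝ} (hhb : ∀ τ, |h τ| ≤ Mh) (hgb : ∀ τ, |g τ| ≤ Mg)
    (hfib : ∀ τ : V → S, (∀ x, x ≠ e → τ x = σ x) → h τ = h σ) :
    ∫ τ, (h τ + g τ - ∫ τ', (h τ' + g τ') ∂(γ {e} σ)) ^ 2 ∂(γ {e} σ) = ∫ τ, (g τ - ∫ τ', g τ' ∂(γ {e} σ)) ^ 2 ∂(γ {e} σ) := by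
  haveI := hγ.isProbability {e} σ
  have hae : ∀ᵐ τ ∂(γ {e} σ), h τ = h σ := by
    filter_upwards [hγ.proper {e} σ] with τ hτ
    exact hfib τ fun x hx => hτ x (by simpa using hx)
  have hint : ∫ τ', (h τ' + g τ') ∂(γ {e} σ) = h σ + ∫ τ', g τ' ∂(γ {e} σ) := by
    rw [integral_add (integrable_of_abs_le hh hhb) (integrable_of_abs_le hg hgb)]
    rw [integral_congr_ae hae, integral_const]; simp
  rw [hint]
  refine integral_congr_ae ?_
  filter_upwards [hae] with τ hτ
  rw [hτ]; ring

/-- ★ **THE SPARSE-FAMILY INDUCTION (kernel form).** Under (F), (P), (C) for the family `E` (see the module docstring), for every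
`E' ⊆ E` and every boundary condition `η`: `Σ_{e∈E'} ∫ f_e dγ_{E'}(·|η) ≤ Var_{γ_{E'}(·|η)}(S₀)`. [folklore] -/
theorem sum_integral_floor_le_variance_kernel (hγ : IsSpecification γ) {E : Finset V} {S₀ : (V → S) → ℝ} (hS : Measurable S₀)
    {MS : ℝ} (hSb : ∀ σ, |S₀ σ| ≤ MS) {g f : V → (V → S) → ℝ} (hgm : ∀ e, Measurable (g e)) {Mg : ℝ}
    (hgb : ∀ e σ, |g e σ| ≤ Mg) (hfm : ∀ e, Measurable (f e)) {Mf : ℝ} (hfb : ∀ e σ, |f e σ| ≤ Mf)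
    (hfloor : ∀ e ∈ E, ∀ (σ : V → S) (c : ℝ), f e σ ≤ ∫ τ, (g e τ - c) ^ 2 ∂(γ {e} σ))
    (hproperG : ∀ e ∈ E, ∀ E' ⊆ E, e ∉ E' → ∀ σ, ∫ τ, g e τ ∂(γ E' σ) = g e σ)
    (hfibre : ∀ e ∈ E, ∀ E' ⊆ E, e ∉ E' → ∀ σ τ : V → S, (∀ x, x ≠ e → τ x = σ x) →
      ∫ ω, (S₀ ω - g e ω) ∂(γ E' τ) = ∫ ω, (S₀ ω - g e ω) ∂(γ E' σ)) :
    ∀ E' ⊆ E, ∀ η : V → S,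
      ∑ e ∈ E', ∫ σ, f e σ ∂(γ E' η) ≤ ∫ τ, (S₀ τ - ∫ τ', S₀ τ' ∂(γ E' η)) ^ 2 ∂(γ E' η) := by
  classical
  intro E' hE'
  induction E' using Finset.induction_on with
  | empty => intro η; simp; exact integral_nonneg fun τ => sq_nonneg _
  | insert e E' he ih =>
    intro η
    have heE : e ∈ E := hE' (Finset.mem_insert_self e E')
    have hE'E : E' ⊆ E := fun x hx => hE' (Finset.mem_insert_of_mem hx)
    have hsub : E' ⊆ insert e E' := Finset.subset_insert e E'
    have hsub1 : ({e} : Finset V) ⊆ insert e E' := Finset.singleton_subset_iff.2 (Finset.mem_insert_self e E')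
    haveI := hγ.isProbability (insert e E') η
    -- split: `Var_{E''}(S₀) = ∫ Var_{E'}(S₀) + Var_{E''}(γ_{E'} S₀)`
    rw [variance_kernel_eq_add hγ hsub η hS hSb, Finset.sum_insert he]
    -- the old sites, through consistency
    have hold : ∑ x ∈ E', ∫ σ, f x σ ∂(γ (insert e E') η) ≤
        ∫ σ, ∫ τ, (S₀ τ - ∫ τ', S₀ τ' ∂(γ E' σ)) ^ 2 ∂(γ E' σ) ∂(γ (insert e E') η) := by
      have hrw : ∀ x ∈ E', ∫ σ, f x σ ∂(γ (insert e E') η) = ∫ σ, ∫ τ, f x τ ∂(γ E' σ) ∂(γ (insert e E') η) := fun x _ =>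
        (integral_integral_kernel_eq hγ hsub η (f x) (hfm x) ⟨Mf, hfb x⟩).symm
      rw [Finset.sum_congr rfl hrw, ← integral_finsetSum _ (fun x _ =>
        integrable_of_abs_le (SpecConcentration.measurable_integral hγ E' (hfm x)) (abs_integral_kernel_le hγ E' (hfb x)))]
      refine integral_mono (integrable_finsetSum _ fun x _ =>
        integrable_of_abs_le (SpecConcentration.measurable_integral hγ E' (hfm x)) (abs_integral_kernel_le hγ E' (hfb x))) ?_ fun σ => ih hE'E σ
      -- integrability of the conditional variance
      have hId : ∀ σ, ∫ τ, (S₀ τ - ∫ τ', S₀ τ' ∂(γ E' σ)) ^ 2 ∂(γ E' σ) = ∫ τ, S₀ τ ^ 2 ∂(γ E' σ) - (∫ τ, S₀ τ ∂(γ E' σ)) ^ 2 :=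
        fun σ => by
          haveI := hγ.isProbability E' σ
          have h := integral_sq_sub_eq (ν := γ E' σ) hS hSb 0
          simp only [sub_zero] at h
          linarith
      simp_rw [hId]
      refine integrable_of_abs_le ((SpecConcentration.measurable_integral hγ E' (hS.pow_const 2)).sub
        ((SpecConcentration.measurable_integral hγ E' hS).pow_const 2)) (M := MS ^ 2 + MS ^ 2) fun σ => ?_
      have h1 : |∫ τ, S₀ τ ^ 2 ∂(γ E' σ)| ≤ MS ^ 2 := abs_integral_kernel_le hγ E' (fun τ => by
        rw [abs_pow, ← sq_abs MS]; exact pow_le_pow_left₀ (abs_nonneg _) ((hSb τ).trans (le_abs_self _)) 2) σ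
      have h2 : |∫ τ, S₀ τ ∂(γ E' σ)| ≤ MS := abs_integral_kernel_le hγ E' hSb σ
      have h3 : (∫ τ, S₀ τ ∂(γ E' σ)) ^ 2 ≤ MS ^ 2 := by
        rw [← sq_abs]; exact pow_le_pow_left₀ (abs_nonneg _) h2 2
      refine (abs_sub _ _).trans ?_
      rw [abs_pow, sq_abs] at *
      have : |(∫ τ, S₀ τ ∂(γ E' σ)) ^ 2| ≤ MS ^ 2 := by rw [abs_of_nonneg (sq_nonneg _)]; exact h3
      linarith
    -- the new site: `Var_{E''}(γ_{E'} S₀) ≥ ∫ Var_{γ_e}(γ_{E'} S₀) dγ_{E''} = ∫ Var_{γ_e}(g_e) ≥ ∫ f_e`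
    have hX : Measurable fun σ => ∫ τ, S₀ τ ∂(γ E' σ) := SpecConcentration.measurable_integral hγ E' hS
    have hXb : ∀ σ, |∫ τ, S₀ τ ∂(γ E' σ)| ≤ MS := abs_integral_kernel_le hγ E' hSb
    have hnew1 := integral_variance_kernel_le hγ {e} (ν := γ (insert e E') η)
      (fun F hF hFb => integral_integral_kernel_eq hγ hsub1 η F hF hFb) hX hXb
    have hnew2 : ∀ σ, f e σ ≤ ∫ τ, ((∫ ω, S₀ ω ∂(γ E' τ)) - ∫ τ', (∫ ω, S₀ ω ∂(γ E' τ')) ∂(γ {e} σ)) ^ 2 ∂(γ {e} σ) := by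
      intro σ
      haveI := hγ.isProbability {e} σ
      -- `γ_{E'} S₀ = h + g_e` with `h = γ_{E'}(S₀ − g_e)` fibre-constant and `γ_{E'} g_e = g_e`
      have hdec : ∀ τ, ∫ ω, S₀ ω ∂(γ E' τ) = (∫ ω, (S₀ ω - g e ω) ∂(γ E' τ)) + g e τ := fun τ => by
        haveI := hγ.isProbability E' τ
        rw [integral_sub (integrable_of_abs_le hS hSb) (integrable_of_abs_le (hgm e) (hgb e)), hproperG e heE E' hE'E he τ]
        ring
      simp_rw [hdec]
      have hhm : Measurable fun τ => ∫ ω, (S₀ ω - g e ω) ∂(γ E' τ) := SpecConcentration.measurable_integral hγ E' (hS.sub (hgm e))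
      have hhb : ∀ τ, |∫ ω, (S₀ ω - g e ω) ∂(γ E' τ)| ≤ MS + Mg := abs_integral_kernel_le hγ E' fun ω =>
        (abs_sub _ _).trans (add_le_add (hSb ω) (hgb e ω))
      rw [variance_fibre_add_eq hγ e σ hhm (hgm e) hhb (hgb e) (fun τ hτ => hfibre e heE E' hE'E he σ τ hτ)]
      exact hfloor e heE σ _
    obtain ⟨hvm, hvb⟩ := measurable_variance_kernel hγ {e} hX hXb
    have hfe : ∫ σ, f e σ ∂(γ (insert e E') η) ≤
        ∫ σ, ((∫ τ, S₀ τ ∂(γ E' σ)) - ∫ σ', ∫ τ, S₀ τ ∂(γ E' σ') ∂(γ (insert e E') η)) ^ 2 ∂(γ (insert e E') η) :=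
      (integral_mono (integrable_of_abs_le (hfm e) (hfb e)) (integrable_of_abs_le hvm hvb) hnew2).trans hnew1
    linarith

/-- ★★ **THE SPARSE-FAMILY VARIANCE FLOOR UNDER A GIBBS MEASURE.** Under (F), (P), (C) for the family `E`, for every Gibbs measure `μ`
of `γ`: `Σ_{e∈E} ∫ f_e dμ ≤ Var_μ(S₀)` — the variance of `S₀` is at least the sum over the sparse family of the averaged one-site floors
(DLR + the kernel form). [folklore] -/
theorem sum_integral_floor_le_variance (hγ : IsSpecification γ) {μ : Measure (V → S)} (hμ : IsGibbsMeasure γ μ) {E : Finset V}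
    {S₀ : (V → S) → ℝ} (hS : Measurable S₀) {MS : ℝ} (hSb : ∀ σ, |S₀ σ| ≤ MS) {g f : V → (V → S) → ℝ}
    (hgm : ∀ e, Measurable (g e)) {Mg : ℝ} (hgb : ∀ e σ, |g e σ| ≤ Mg) (hfm : ∀ e, Measurable (f e)) {Mf : ℝ}
    (hfb : ∀ e σ, |f e σ| ≤ Mf) (hfloor : ∀ e ∈ E, ∀ (σ : V → S) (c : ℝ), f e σ ≤ ∫ τ, (g e τ - c) ^ 2 ∂(γ {e} σ))
    (hproperG : ∀ e ∈ E, ∀ E' ⊆ E, e ∉ E' → ∀ σ, ∫ τ, g e τ ∂(γ E' σ) = g e σ)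
    (hfibre : ∀ e ∈ E, ∀ E' ⊆ E, e ∉ E' → ∀ σ τ : V → S, (∀ x, x ≠ e → τ x = σ x) →
      ∫ ω, (S₀ ω - g e ω) ∂(γ E' τ) = ∫ ω, (S₀ ω - g e ω) ∂(γ E' σ)) :
    ∑ e ∈ E, ∫ σ, f e σ ∂μ ≤ ∫ τ, (S₀ τ - ∫ τ', S₀ τ' ∂μ) ^ 2 ∂μ := by
  classical
  haveI := hμ.isProbabilityMeasure
  have hker := sum_integral_floor_le_variance_kernel hγ hS hSb hgm hgb hfm hfb hfloor hproperG hfibre E subset_rfl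
  -- DLR: `∫ f_e dμ = ∫ (∫ f_e dγ_E) dμ`, and `∫ Var_{γ_E} dμ ≤ Var_μ`
  have hDLR : ∀ (F : (V → S) → ℝ), Measurable F → (∃ C, ∀ σ, |F σ| ≤ C) → ∫ σ, ∫ τ, F τ ∂(γ E σ) ∂μ = ∫ τ, F τ ∂μ :=
    fun F hF ⟨C, hC⟩ => hμ.integral_integral_eq hγ E (integrable_of_abs_le hF hC)
  have htv := integral_variance_kernel_le hγ E (ν := μ) hDLR hS hSb
  obtain ⟨hvm, hvb⟩ := measurable_variance_kernel hγ E hS hSb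
  calc ∑ e ∈ E, ∫ σ, f e σ ∂μ = ∑ e ∈ E, ∫ σ, ∫ τ, f e τ ∂(γ E σ) ∂μ :=
        Finset.sum_congr rfl fun e _ => (hDLR (f e) (hfm e) ⟨Mf, hfb e⟩).symm
    _ = ∫ σ, ∑ e ∈ E, ∫ τ, f e τ ∂(γ E σ) ∂μ := (integral_finsetSum _ fun e _ =>
        integrable_of_abs_le (SpecConcentration.measurable_integral hγ E (hfm e)) (abs_integral_kernel_le hγ E (hfb e))).symm
    _ ≤ ∫ σ, ∫ τ, (S₀ τ - ∫ τ', S₀ τ' ∂(γ E σ)) ^ 2 ∂(γ E σ) ∂μ :=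
        integral_mono (integrable_finsetSum _ fun e _ =>
          integrable_of_abs_le (SpecConcentration.measurable_integral hγ E (hfm e)) (abs_integral_kernel_le hγ E (hfb e)))
          (integrable_of_abs_le hvm hvb) fun σ => hker σ
    _ ≤ ∫ τ, (S₀ τ - ∫ τ', S₀ τ' ∂μ) ^ 2 ∂μ := htv

end KernelVariance

end Summit.Ventures.YMGap.RobustBall

end
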